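import Summits.QuantumFields.YangMills.Theorems.BalabanUVNodesN19SingleModeLogFree
import Summits.QuantumFields.YangMills.Theorems.BalabanUVNodesN19OscillatingLinksMultiscale

/-!
# YM-DAG node N19 (= NE7 proper) — THE LOG-FREE WIENER CLASS: links whose DERIVATIVE has an absolutely summable Fourier series cost
# `≤ 80·d·‖h′‖_A∕t` on the cube (linearity over the log-free single mode); the «logarithmic» Dirichlet profiles cost `≤ 80·d∕t`

Cell `pub-ymgap`, HUMAN RULING D-0062 (Track A) ∕ D-0149 (work-bound push), R141 (C) wider-strategy seat `pub-ymgap-dag-n19-e` (strategy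
s3 = ALTERNATIVE CURRENCY), generation g34, module 9 (lineage module 184).  Route `Summits/QuantumFields/YangMills/Theses/BalabanUVNodes.lean`,
cluster item K3⁸ «SpineGivenEndpointR13SepCoPHV» (stmt-QuantumFields-27366); filed `--supports` that item `--as helper` (it proves no registered
stub).  COUNT-NEUTRAL: [folklore]∕[bookkeeping] over Mathlib and, BY NAME, module 140 `…N19SingleModeLogFree`
(`exists_mvPolynomial_near_cos_l1Norm_logFree`, `exists_mvPolynomial_near_sin_l1Norm_logFree`: `dist_∞(cos ∕ sin(ωS_d), Π_t) ≤ 80ωd∕t` for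
`ωd·log₂²t ≤ t∕2048`) and module 120 `…N19OscillatingLinksMultiscale` (`l1Norm_mem_Icc`); no laws, no scheme object, no Theses import; NOT a discharge
claim.

WHY (desk `numerics/OPEN-PROBLEM.md`, g34 addendum).  After modules 176–183 the general Lipschitz row reads `d∕(π(9t+6)) ≤ E_d(t) ≤ 75000·d·log₂t∕t`,
and the last logarithm is intrinsic to the ladder method.  Is it real?  By LINEARITY over module 140's LOG-FREE single mode, a trigonometric link
`h = c + Σ_n(a_n cos ω_n· + b_n sin ω_n·)` costs `≤ (80d∕t)·Σ_n(|a_n| + |b_n|)ω_n = (80d∕t)·‖h′‖_A` (the Wiener norm of the DERIVATIVE) — NO logarithm —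
as long as every frequency is in the log-free regime `ω_n d·log₂²t ≤ t∕2048`.  So a logarithm in `E_d(t)` can only come from links with
`‖h′‖_A ≫ ‖h′‖_∞`, i.e. from JUMPS of `h′` (the hinge `|s − d∕2|`: `‖h′_{≤N}‖_A ≍ log N`); many scales alone do not produce it: the «logarithmic»
Dirichlet profile `h_N(s) = (d∕(πN))Σ_{1≤n≤N} cos(πns∕d)∕n` (`1`-Lipschitz on `[0,d]`, `N` active scales, `‖h_N′‖_A = 1`) costs `≤ 80d∕t`.
CONTENT.  §1 ★★ `exists_mvPolynomial_near_trigSum_l1Norm_logFree` (the linearity bookkeeping, one budget `t` for all modes); §2 ★★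
`exists_mvPolynomial_near_link_of_trigApprox_logFree` (links within `τ` of such a sum on `[0, d]`: `≤ τ + (80d∕t)Σ(|a_n| + |b_n|)ω_n`); §3 ★
`exists_mvPolynomial_near_logDirichlet_l1Norm` (the profile `h_N∘S_d` at `≤ 80d∕t` whenever `πN·log₂²t ≤ t∕2048`).

HONEST FRAMING (binding).  Elementary and [folklore]; ONE-SIDED; constants astronomical; NO consumer in the DAG today (the seat's own currency map,
degree model); nothing of Bałaban's instantiated; NE7 NOT PRINTED, NOT proved; N19 NOT discharged; count-neutral.  One finite `T⁴` programme at
fixed `ε`; nothing continuum ∕ `ℝ⁴` ∕ OS ∕ mass-gap ∕ Clay.  0 `def` ∕ 0 `sorry`.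
-/

noncomputable section

open Finset
open scoped Real

namespace Summit.QuantumFields.YangMills.Theorems.BalabanUVNodesN19WienerClassLogFree

open Summit.QuantumFields.YangMills.Theorems.BalabanUVNodesN19SingleModeLogFree
  (exists_mvPolynomial_near_cos_l1Norm_logFree exists_mvPolynomial_near_sin_l1Norm_logFree)
open Summit.QuantumFields.YangMills.Theorems.BalabanUVNodesN19OscillatingLinksMultiscale (l1Norm_mem_Icc)

variable {ι : Type*} [Fintype ι]

/-! ## §1 ★★ Trigonometric links by linearity over the log-free single mode [folklore] -/

/-- ★★ **TRIGONOMETRIC LINKS OF THE ℓ¹-NORM, LOG-FREE.**  For `t ≥ 512`, frequencies `0 ≤ ω_n ≤ Ω` (`n < N`) with `Ωd·(log₂t)² ≤ t∕2048`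
(`d = |ι|`) and coefficients `a_n, b_n, c` there is `P : MvPolynomial ι ℝ` of total degree `≤ t` with
`|c + Σ_{n<N}(a_n cos(ω_nS(x)) + b_n sin(ω_nS(x))) − P(x)| ≤ (80d∕t)·Σ_{n<N}(|a_n| + |b_n|)ω_n` on `[−1,1]^ι` (`S(x) = Σ_i|x_i|`): module 140's cos ∕ sin
faces mode by mode (each at `80ω_n d∕t`, degree `≤ t`), summed.  The right-hand side is `(80d∕t)·‖h′‖_A` for `h = c + Σ(a_n cos ω_n· + b_n sin ω_n·)` —
NO logarithm. [folklore] -/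
theorem exists_mvPolynomial_near_trigSum_l1Norm_logFree {t : ℕ} (ht : 512 ≤ t) (c : ℝ) (a b ω : ℕ → ℝ) (N : ℕ) {Ω : ℝ}
    (hω0 : ∀ n, 0 ≤ ω n) (hωΩ : ∀ n, n < N → ω n ≤ Ω) (hreg : Ω * Fintype.card ι * Real.logb 2 t ^ 2 ≤ t / 2048) :
    ∃ P : MvPolynomial ι ℝ, P.totalDegree ≤ t ∧
      ∀ x : ι → ℝ, (∀ i, x i ∈ Set.Icc (-1 : ℝ) 1) →
        |(c + ∑ n ∈ range N, (a n * Real.cos (ω n * ∑ i, |x i|) + b n * Real.sin (ω n * ∑ i, |x i|))) -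
            MvPolynomial.eval x P| ≤
          80 * Fintype.card ι / t * ∑ n ∈ range N, (|a n| + |b n|) * ω n := by
  classical
  set d : ℝ := (Fintype.card ι : ℝ) with hd
  have hd0 : 0 ≤ d := Nat.cast_nonneg _
  have ht0 : (0 : ℝ) < t := by exact_mod_cast (show 0 < t by omega)
  -- every listed frequency is in the log-free regime
  have hregn : ∀ n, n < N → ω n * Fintype.card ι * Real.logb 2 t ^ 2 ≤ t / 2048 := by
    intro n hn
    have h1 : ω n * d * Real.logb 2 t ^ 2 ≤ Ω * d * Real.logb 2 t ^ 2 :=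
      mul_le_mul_of_nonneg_right (mul_le_mul_of_nonneg_right (hωΩ n hn) hd0) (sq_nonneg _)
    rw [← hd]; exact h1.trans hreg
  -- mode-wise polynomials (junk outside `n < N`)
  have hPc : ∀ n, ∃ P : MvPolynomial ι ℝ, n < N → P.totalDegree ≤ t ∧
      ∀ x : ι → ℝ, (∀ i, x i ∈ Set.Icc (-1 : ℝ) 1) →
        |Real.cos (ω n * ∑ i, |x i|) - MvPolynomial.eval x P| ≤ 80 * (ω n * Fintype.card ι) / t := by
    intro n
    by_cases hn : n < N
    · obtain ⟨P, hP, herr⟩ := exists_mvPolynomial_near_cos_l1Norm_logFree (ι := ι) ht (hω0 n) (hregn n hn)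
      exact ⟨P, fun _ => ⟨hP, herr⟩⟩
    · exact ⟨0, fun h => absurd h hn⟩
  have hPs : ∀ n, ∃ P : MvPolynomial ι ℝ, n < N → P.totalDegree ≤ t ∧
      ∀ x : ι → ℝ, (∀ i, x i ∈ Set.Icc (-1 : ℝ) 1) →
        |Real.sin (ω n * ∑ i, |x i|) - MvPolynomial.eval x P| ≤ 80 * (ω n * Fintype.card ι) / t := by
    intro n
    by_cases hn : n < N
    · obtain ⟨P, hP, herr⟩ := exists_mvPolynomial_near_sin_l1Norm_logFree (ι := ι) ht (hω0 n) (hregn n hn)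
      exact ⟨P, fun _ => ⟨hP, herr⟩⟩
    · exact ⟨0, fun h => absurd h hn⟩
  choose Pc hPc' using hPc
  choose Ps hPs' using hPs
  refine ⟨MvPolynomial.C c + ∑ n ∈ range N, (MvPolynomial.C (a n) * Pc n + MvPolynomial.C (b n) * Ps n), ?_, ?_⟩
  · refine (MvPolynomial.totalDegree_add _ _).trans (max_le ?_ ?_)
    · rw [MvPolynomial.totalDegree_C]; exact Nat.zero_le _
    · refine MvPolynomial.totalDegree_finsetSum_le fun n hn => ?_
      have hn' : n < N := mem_range.1 hn
      refine (MvPolynomial.totalDegree_add _ _).trans (max_le ?_ ?_)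
      · calc (MvPolynomial.C (a n) * Pc n).totalDegree ≤ (MvPolynomial.C (a n) : MvPolynomial ι ℝ).totalDegree + (Pc n).totalDegree :=
            MvPolynomial.totalDegree_mul _ _
          _ ≤ 0 + t := by rw [MvPolynomial.totalDegree_C]; exact add_le_add le_rfl (hPc' n hn').1
          _ = t := zero_add _
      · calc (MvPolynomial.C (b n) * Ps n).totalDegree ≤ (MvPolynomial.C (b n) : MvPolynomial ι ℝ).totalDegree + (Ps n).totalDegree :=
            MvPolynomial.totalDegree_mul _ _
          _ ≤ 0 + t := by rw [MvPolynomial.totalDegree_C]; exact add_le_add le_rfl (hPs' n hn').1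
          _ = t := zero_add _
  · intro x hx
    have hev : MvPolynomial.eval x (MvPolynomial.C c + ∑ n ∈ range N, (MvPolynomial.C (a n) * Pc n + MvPolynomial.C (b n) * Ps n)) =
        c + ∑ n ∈ range N, (a n * MvPolynomial.eval x (Pc n) + b n * MvPolynomial.eval x (Ps n)) := by
      rw [map_add, MvPolynomial.eval_C, map_sum]
      refine congrArg _ (Finset.sum_congr rfl fun n _ => ?_)
      rw [map_add, map_mul, map_mul, MvPolynomial.eval_C, MvPolynomial.eval_C]
    rw [hev, add_sub_add_left_eq_sub, ← Finset.sum_sub_distrib, Finset.mul_sum]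
    refine (abs_sum_le_sum_abs _ _).trans (Finset.sum_le_sum fun n hn => ?_)
    have hn' : n < N := mem_range.1 hn
    have e : a n * Real.cos (ω n * ∑ i, |x i|) + b n * Real.sin (ω n * ∑ i, |x i|) -
        (a n * MvPolynomial.eval x (Pc n) + b n * MvPolynomial.eval x (Ps n)) =
        a n * (Real.cos (ω n * ∑ i, |x i|) - MvPolynomial.eval x (Pc n)) +
          b n * (Real.sin (ω n * ∑ i, |x i|) - MvPolynomial.eval x (Ps n)) := by ring
    rw [e]
    calc |a n * (Real.cos (ω n * ∑ i, |x i|) - MvPolynomial.eval x (Pc n)) +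
          b n * (Real.sin (ω n * ∑ i, |x i|) - MvPolynomial.eval x (Ps n))|
        ≤ |a n * (Real.cos (ω n * ∑ i, |x i|) - MvPolynomial.eval x (Pc n))| +
          |b n * (Real.sin (ω n * ∑ i, |x i|) - MvPolynomial.eval x (Ps n))| := abs_add_le _ _
      _ ≤ |a n| * (80 * (ω n * Fintype.card ι) / t) + |b n| * (80 * (ω n * Fintype.card ι) / t) := by
          rw [abs_mul, abs_mul]
          exact add_le_add (mul_le_mul_of_nonneg_left ((hPc' n hn').2 x hx) (abs_nonneg _))
            (mul_le_mul_of_nonneg_left ((hPs' n hn').2 x hx) (abs_nonneg _))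
      _ = 80 * Fintype.card ι / t * ((|a n| + |b n|) * ω n) := by ring

/-! ## §2 ★★ Links with a trigonometric approximation, log-free [folklore] -/

/-- ★★ **THE LOG-FREE WIENER CLASS.**  If `|h(s) − (c + Σ_{n<N}(a_n cos(ω_ns) + b_n sin(ω_ns)))| ≤ τ` for `s ∈ [0, d]` with `0 ≤ ω_n ≤ Ω`
(`n < N`), `Ωd·(log₂t)² ≤ t∕2048`, `t ≥ 512`, then there is `P : MvPolynomial ι ℝ` of total degree `≤ t` with
`|h(Σ_i|x_i|) − P(x)| ≤ τ + (80d∕t)·Σ_{n<N}(|a_n| + |b_n|)ω_n` on `[−1,1]^ι`.  READING: a link whose DERIVATIVE has an absolutely summable Fourier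
series, `‖h′‖_A := Σ_n(|a_n| + |b_n|)ω_n < ∞`, costs `≤ 80·d·‖h′‖_A∕t` plus the truncation error — NO logarithm; the `log t` of the general row
(module 176) can only come from `‖h′_{≤N}‖_A ≫ ‖h′‖_∞`, i.e. from jumps of `h′`. [folklore] -/
theorem exists_mvPolynomial_near_link_of_trigApprox_logFree {t : ℕ} (ht : 512 ≤ t) {h : ℝ → ℝ} (c : ℝ) (a b ω : ℕ → ℝ) (N : ℕ)
    {Ω τ : ℝ} (hω0 : ∀ n, 0 ≤ ω n) (hωΩ : ∀ n, n < N → ω n ≤ Ω) (hreg : Ω * Fintype.card ι * Real.logb 2 t ^ 2 ≤ t / 2048)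
    (happrox : ∀ s : ℝ, 0 ≤ s → s ≤ Fintype.card ι →
      |h s - (c + ∑ n ∈ range N, (a n * Real.cos (ω n * s) + b n * Real.sin (ω n * s)))| ≤ τ) :
    ∃ P : MvPolynomial ι ℝ, P.totalDegree ≤ t ∧
      ∀ x : ι → ℝ, (∀ i, x i ∈ Set.Icc (-1 : ℝ) 1) →
        |h (∑ i, |x i|) - MvPolynomial.eval x P| ≤ τ + 80 * Fintype.card ι / t * ∑ n ∈ range N, (|a n| + |b n|) * ω n := by
  obtain ⟨P, hdeg, herr⟩ := exists_mvPolynomial_near_trigSum_l1Norm_logFree (ι := ι) ht c a b ω N hω0 hωΩ hreg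
  refine ⟨P, hdeg, fun x hx => ?_⟩
  have hS := l1Norm_mem_Icc x hx
  exact (abs_sub_le _ _ _).trans (add_le_add (happrox _ hS.1 hS.2) (herr x hx))

/-! ## §3 ★ The logarithmic Dirichlet profiles are log-free [folklore] -/

/-- ★ **MANY SCALES, NO LOGARITHM.**  The «logarithmic» Dirichlet profile `h_N(s) = (d∕(πN))·Σ_{n<N} cos(π(n+1)s∕d)∕(n+1)` (`1`-Lipschitz on `ℝ`:
`|h_N′| ≤ (d∕(πN))Σ_{n<N}(π(n+1)∕d)∕(n+1) = 1`; `N` active dyadic-and-finer scales; `‖h_N′‖_A = 1`) satisfies, for `t ≥ 512` and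
`πN·(log₂t)² ≤ t∕2048` (finite nonempty `ι`, `d = |ι|`): there is `P` of total degree `≤ t` with `|h_N(Σ_i|x_i|) − P(x)| ≤ 80·d∕t` on `[−1,1]^ι`
(§1 with `a_n = d∕(πN(n+1))`, `ω_n = π(n+1)∕d`, `Σ_n a_nω_n = 1`). [folklore] -/
theorem exists_mvPolynomial_near_logDirichlet_l1Norm [Nonempty ι] {t : ℕ} (ht : 512 ≤ t) {N : ℕ} (hN : 1 ≤ N)
    (hreg : π * N * Real.logb 2 t ^ 2 ≤ t / 2048) :
    ∃ P : MvPolynomial ι ℝ, P.totalDegree ≤ t ∧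
      ∀ x : ι → ℝ, (∀ i, x i ∈ Set.Icc (-1 : ℝ) 1) →
        |(Fintype.card ι / (π * N) * ∑ n ∈ range N, Real.cos (π * (n + 1) / Fintype.card ι * ∑ i, |x i|) / (n + 1)) -
            MvPolynomial.eval x P| ≤ 80 * Fintype.card ι / t := by
  set d : ℝ := (Fintype.card ι : ℝ) with hd
  have hdpos : 0 < d := by rw [hd]; exact_mod_cast Fintype.card_pos
  have hNr : (0 : ℝ) < N := by exact_mod_cast hN
  have hπ := Real.pi_pos
  -- the data of §1
  set a : ℕ → ℝ := fun n => d / (π * N * (n + 1)) with ha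
  set ω : ℕ → ℝ := fun n => π * (n + 1) / d with hω
  have hω0 : ∀ n, 0 ≤ ω n := fun n => by rw [hω]; positivity
  have hωΩ : ∀ n, n < N → ω n ≤ π * N / d := by
    intro n hn
    rw [hω]
    have h1 : (n : ℝ) + 1 ≤ N := by exact_mod_cast Nat.succ_le_of_lt hn
    exact div_le_div_of_nonneg_right (mul_le_mul_of_nonneg_left h1 hπ.le) hdpos.le
  have hreg' : π * N / d * Fintype.card ι * Real.logb 2 t ^ 2 ≤ t / 2048 := by
    rw [← hd, div_mul_cancel₀ _ hdpos.ne']; exact hreg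
  obtain ⟨P, hdeg, herr⟩ := exists_mvPolynomial_near_trigSum_l1Norm_logFree (ι := ι) ht 0 a (fun _ => 0) ω N hω0 hωΩ hreg'
  refine ⟨P, hdeg, fun x hx => ?_⟩
  have h1 := herr x hx
  -- identify the sum
  have hsum : (0 : ℝ) + ∑ n ∈ range N, (a n * Real.cos (ω n * ∑ i, |x i|) + 0 * Real.sin (ω n * ∑ i, |x i|)) =
      d / (π * N) * ∑ n ∈ range N, Real.cos (π * (n + 1) / d * ∑ i, |x i|) / (n + 1) := by
    rw [zero_add, Finset.mul_sum]
    refine Finset.sum_congr rfl fun n _ => ?_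
    rw [zero_mul, add_zero, ha, hω]
    have hn1 : (0 : ℝ) < n + 1 := by positivity
    field_simp
  -- the Wiener norm of the derivative is `1`
  have hmass : ∑ n ∈ range N, (|a n| + |(fun _ : ℕ => (0 : ℝ)) n|) * ω n = 1 := by
    have hterm : ∀ n ∈ range N, (|a n| + |(fun _ : ℕ => (0 : ℝ)) n|) * ω n = 1 / N := by
      intro n _
      have hn1 : (0 : ℝ) < n + 1 := by positivity
      rw [ha, hω, abs_zero, add_zero, abs_of_pos (by positivity)]
      field_simp
    rw [Finset.sum_congr rfl hterm, Finset.sum_const, card_range, nsmul_eq_mul]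
    field_simp
  rw [hsum, hmass, mul_one, ← hd] at h1
  exact h1

end Summit.QuantumFields.YangMills.Theorems.BalabanUVNodesN19WienerClassLogFree

end
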